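import Mathlib
import Literature.Analysis.FluidPDE.WeakL3SteadyLiouville
import Literature.Analysis.FluidPDE.SelfSimilar
import Summits.NavierStokesRegularity.NavierStokesRegularity.Theses.RootDecompEternalSpike

/-!
# SPL banked: the steady enveloped Liouville rung of N28 `RootDecompEternalSpike`

Item `SteadyEnvelopedLiouville` (aside; the steady stratum of the door NEP): a steady Leray profile
(`IsLerayProfile ν 0 U P`, any `ν > 0`) with a weak-`L³` envelope `sup_σ σ³·|{σ < ‖U‖}| < ∞` vanishes identically.
Proof = lens-4 g16 `steadyEnvelopedLiouville` re-proved over the tree: the envelope is `MemWeakLp U 3`, then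
`WeakL3SteadyLiouville.eq_zero_of_memWeakLp_three` (Tsai 2021 Thm 1.1(a) / Seregin–Wang 2020 Thm 1.1(ii)).
-/

noncomputable section

open MeasureTheory Set Function Filter Topology
open scoped NNReal ENNReal
open Literature.Analysis Literature.Analysis.FluidPDE

namespace Summit.NavierStokesRegularity.NavierStokesRegularity.Theorems



/-- SPL holds (Tsai 2021 Thm 1.1(a) via the tree theorem `WeakL3SteadyLiouville.eq_zero_of_memWeakLp_three`). -/
theorem rootDecompEternalSpike_steadyEnvelopedLiouville_proof : Summit.NavierStokesRegularity.NavierStokesRegularity.Theses.RootDecompEternalSpike.SteadyEnvelopedLiouville := by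
  intro ν hν U P hprof hM
  obtain ⟨M, hM, hle⟩ := hM
  refine WeakL3SteadyLiouville.eq_zero_of_memWeakLp_three hν hprof ⟨?_, ?_⟩
  · exact hprof.contDiff_velocity.continuous.aestronglyMeasurable
  · refine lt_of_le_of_lt ?_ hM
    rw [FunctionSpaces.eWeakLpPow_le_iff]
    intro r
    rcases eq_or_ne r 0 with rfl | hr
    · simp
    · have hr' : 0 < (r : ℝ) := NNReal.coe_pos.2 (pos_iff_ne_zero.2 hr)
      have h3 : (3 : ℝ≥0∞).toReal = ((3 : ℕ) : ℝ) := by norm_num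
      have hset : {x : EuclideanSpace ℝ (Fin 3) | (r : ℝ≥0∞) < ‖U x‖ₑ} = {x | (r : ℝ) < ‖U x‖} := by
        ext x
        simp only [mem_setOf_eq]
        rw [← ofReal_norm, ENNReal.lt_ofReal_iff_toReal_lt ENNReal.coe_ne_top, ENNReal.coe_toReal]
      rw [h3, ENNReal.rpow_natCast, hset, ← ENNReal.ofReal_coe_nnreal]
      exact hle r hr'

end Summit.NavierStokesRegularity.NavierStokesRegularity.Theorems

end
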